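import Literature.MathematicalPhysics.QuantumLattice.PatchPairOperator
import Literature.MathematicalPhysics.QuantumLattice.ApproximateEigenvectorLemmas
import Literature.MathematicalPhysics.QuantumLattice.DWaveSourceFreeGainBound
import Literature.MathematicalPhysics.QuantumLattice.HubbardFreeCovariance

/-!
# Crux `CwThesis` (item `stmt-HubbardSuperconductivity-10438`): the pair intensity of a state with a sharp
# spin-`↑` Fermi step is `O(L²)`

Negative-side support (standing disprover, free-endpoint programme, file 2). On the fermionic torus
`(ℤ/Lℤ)²` let `ψ` be a unit vector and `μ` a real number such that, in the Bloch modes of `ReducedBCSTorus`,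

* `c_{k↑} ψ = 0` whenever `ε_L(k) > μ` (no `↑` electron above `μ`), and
* `c†_{k↑} ψ = 0` whenever `ε_L(k) < μ` (every `↑` mode below `μ` filled).

Then the `d_{x²-y²}` pair intensity is small:
`re⟨ψ, P†P ψ⟩ ≤ 8·(2·4·L² + 2·(2·#{ε_L = μ})²)` (`re_expect_pairIntensity_le_of_fermiStep`), where
`P = pairField dWaveFormFactor L = -2√2 Σ_k ĝ_d(k) b_k` (`pairField_dWave_eq_smul_pairOperator`,
`b_k = c_{-k↓} c_{k↑}`); with the level-set bound `#{ε_L = μ} ≤ 2L` (file 1) this is `≤ 320 L²`.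
Mechanism: `b_k ψ = 0` above `μ`; below `μ` the vectors `b_k ψ` are pairwise orthogonal (`c†_{k'↑}`
anticommutes through `b†_{k'} b_k` onto `ψ`) and of norm `≤ 1`; on the level set the triangle inequality
costs a factor `#{ε_L = μ}`. Every free-fermion sector ground state has such a Fermi step (file 3), which
gives the `U = 0` endpoint of the crux. Folklore CAR bookkeeping; no definitions.
-/

noncomputable section

namespace Summit.HubbardSuperconductivity.CwThesis.Negative

open Matrix Finset Literature.MathematicalPhysics.QuantumLattice Literature.Probability.LatticeModels
open scoped ComplexOrder ComplexConjugate

variable {L : ℕ} [NeZero L]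

/-! ### Mode calculus on vectors -/

omit [NeZero L] in
/-- `⟨x, Aᴴ y⟩ = ⟨A x, y⟩`. [folklore] -/
theorem star_dotProduct_conjTranspose_mulVec' {n : Type*} [Fintype n] (A : Matrix n n ℂ) (x y : n → ℂ) :
    star x ⬝ᵥ (Aᴴ *ᵥ y) = star (A *ᵥ x) ⬝ᵥ y := by
  rw [star_mulVec, dotProduct_mulVec]

omit [NeZero L] in
/-- `⟨x, A y⟩ = ⟨Aᴴ x, y⟩`. [folklore] -/
theorem star_dotProduct_mulVec_eq {n : Type*} [Fintype n] (A : Matrix n n ℂ) (x y : n → ℂ) :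
    star x ⬝ᵥ (A *ᵥ y) = star (Aᴴ *ᵥ x) ⬝ᵥ y := by
  rw [← star_dotProduct_conjTranspose_mulVec', conjTranspose_conjTranspose]

/-- **The one-mode Pythagoras**: `‖c_{kσ} φ‖² + ‖c†_{kσ} φ‖² = ‖φ‖²` (the mixed CAR `c c† + c† c = 1`). [folklore] -/
theorem eucNorm_sq_ann_add_eucNorm_sq_cre (k : TorusSite 2 L) (σ : Fin 2) (φ : Fock (Orb (FermionTorus 2 L))) :
    eucNorm (momentumAnnihilation k σ *ᵥ φ) ^ 2 + eucNorm (momentumCreation k σ *ᵥ φ) ^ 2 = eucNorm φ ^ 2 := by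
  have h1 : star (momentumAnnihilation k σ *ᵥ φ) ⬝ᵥ (momentumAnnihilation k σ *ᵥ φ) =
      star φ ⬝ᵥ ((momentumCreation k σ * momentumAnnihilation k σ) *ᵥ φ) := by
    rw [← mulVec_mulVec, ← momentumAnnihilation_conjTranspose, star_dotProduct_conjTranspose_mulVec']
  have h2 : star (momentumCreation k σ *ᵥ φ) ⬝ᵥ (momentumCreation k σ *ᵥ φ) =
      star φ ⬝ᵥ ((momentumAnnihilation k σ * momentumCreation k σ) *ᵥ φ) := by
    rw [← mulVec_mulVec, ← star_dotProduct_conjTranspose_mulVec', momentumCreation_conjTranspose]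
  have hsum : star (momentumAnnihilation k σ *ᵥ φ) ⬝ᵥ (momentumAnnihilation k σ *ᵥ φ) +
      star (momentumCreation k σ *ᵥ φ) ⬝ᵥ (momentumCreation k σ *ᵥ φ) = star φ ⬝ᵥ φ := by
    rw [h1, h2, ← dotProduct_add, ← add_mulVec, add_comm, momentumAnnihilation_mul_momentumCreation_add,
      if_pos ⟨rfl, rfl⟩, one_mulVec]
  have := congrArg Complex.re hsum
  rw [Complex.add_re, ← eucNorm_sq, ← eucNorm_sq, ← eucNorm_sq] at this
  exact this

/-- Annihilators are contractions: `‖c_{kσ} φ‖ ≤ ‖φ‖`. [folklore] -/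
theorem eucNorm_momentumAnnihilation_mulVec_le (k : TorusSite 2 L) (σ : Fin 2)
    (φ : Fock (Orb (FermionTorus 2 L))) :
    eucNorm (momentumAnnihilation k σ *ᵥ φ) ≤ eucNorm φ := by
  have h := eucNorm_sq_ann_add_eucNorm_sq_cre k σ φ
  nlinarith [eucNorm_nonneg (momentumAnnihilation k σ *ᵥ φ), eucNorm_nonneg φ,
    sq_nonneg (eucNorm (momentumCreation k σ *ᵥ φ))]

/-- Creators are contractions: `‖c†_{kσ} φ‖ ≤ ‖φ‖`. [folklore] -/
theorem eucNorm_momentumCreation_mulVec_le (k : TorusSite 2 L) (σ : Fin 2)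
    (φ : Fock (Orb (FermionTorus 2 L))) :
    eucNorm (momentumCreation k σ *ᵥ φ) ≤ eucNorm φ := by
  have h := eucNorm_sq_ann_add_eucNorm_sq_cre k σ φ
  nlinarith [eucNorm_nonneg (momentumCreation k σ *ᵥ φ), eucNorm_nonneg φ,
    sq_nonneg (eucNorm (momentumAnnihilation k σ *ᵥ φ))]

/-- The occupation expectation is the squared norm of the annihilated vector:
`re⟨φ, n_{kσ} φ⟩ = ‖c_{kσ} φ‖²`. [folklore] -/
theorem re_expect_momentumNumber (k : TorusSite 2 L) (σ : Fin 2) (φ : Fock (Orb (FermionTorus 2 L))) :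
    (star φ ⬝ᵥ (momentumNumber k σ *ᵥ φ)).re = eucNorm (momentumAnnihilation k σ *ᵥ φ) ^ 2 := by
  rw [momentumNumber, ← mulVec_mulVec, ← momentumAnnihilation_conjTranspose,
    star_dotProduct_conjTranspose_mulVec', eucNorm_sq]

/-- The hole expectation is the squared norm of the created vector:
`‖φ‖² - re⟨φ, n_{kσ} φ⟩ = ‖c†_{kσ} φ‖²`. [folklore] -/
theorem eucNorm_sq_sub_re_expect_momentumNumber (k : TorusSite 2 L) (σ : Fin 2)
    (φ : Fock (Orb (FermionTorus 2 L))) :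
    eucNorm φ ^ 2 - (star φ ⬝ᵥ (momentumNumber k σ *ᵥ φ)).re = eucNorm (momentumCreation k σ *ᵥ φ) ^ 2 := by
  rw [re_expect_momentumNumber, ← eucNorm_sq_ann_add_eucNorm_sq_cre k σ φ]
  ring

/-! ### Pair modes against a sharp `↑` Fermi step -/

/-- `b_k ψ = 0` when `c_{k↑} ψ = 0`. [folklore] -/
theorem pairMode_mulVec_eq_zero_of_up {k : TorusSite 2 L} {ψ : Fock (Orb (FermionTorus 2 L))}
    (h : momentumAnnihilation k 0 *ᵥ ψ = 0) : pairMode k *ᵥ ψ = 0 := by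
  rw [pairMode, ← mulVec_mulVec, h, mulVec_zero]

/-- `‖b_k ψ‖ ≤ ‖ψ‖`. [folklore] -/
theorem eucNorm_pairMode_mulVec_le (k : TorusSite 2 L) (ψ : Fock (Orb (FermionTorus 2 L))) :
    eucNorm (pairMode k *ᵥ ψ) ≤ eucNorm ψ := by
  rw [pairMode, ← mulVec_mulVec]
  exact (eucNorm_momentumAnnihilation_mulVec_le _ _ _).trans (eucNorm_momentumAnnihilation_mulVec_le _ _ _)

/-- Moving `c†_{k'↑}` through `b†_{k'} b_k` for `k ≠ k'`:
`c†_{k'↑} c†_{-k'↓} c_{-k↓} c_{k↑} = - c†_{-k'↓} c_{-k↓} c_{k↑} c†_{k'↑}` (three anticommutations, no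
contractions). [folklore] -/
theorem creationUp_mul_through {k k' : TorusSite 2 L} (hkk' : k ≠ k') :
    momentumCreation k' 0 * (momentumCreation (-k') 1 * (momentumAnnihilation (-k) 1 * momentumAnnihilation k 0)) =
      -(momentumCreation (-k') 1 * (momentumAnnihilation (-k) 1 * (momentumAnnihilation k 0 * momentumCreation k' 0))) := by
  have h1 : momentumCreation k' 0 * momentumCreation (-k') 1 = -(momentumCreation (-k') 1 * momentumCreation k' 0) :=
    momentumCreation_mul_eq_neg k' (-k') 0 1
  have h2 : momentumCreation k' 0 * momentumAnnihilation (-k) 1 = -(momentumAnnihilation (-k) 1 * momentumCreation k' 0) := by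
    have h := momentumAnnihilation_mul_momentumCreation (-k) k' 1 0
    have hne : ¬ (-k = k' ∧ (1 : Fin 2) = 0) := fun h => absurd h.2 (by decide)
    rw [if_neg hne, zero_sub] at h
    rw [h, neg_neg]
  have h3 : momentumCreation k' 0 * momentumAnnihilation k 0 = -(momentumAnnihilation k 0 * momentumCreation k' 0) := by
    have h := momentumAnnihilation_mul_momentumCreation k k' 0 0
    have hne : ¬ (k = k' ∧ (0 : Fin 2) = 0) := fun h => hkk' h.1
    rw [if_neg hne, zero_sub] at h
    rw [h, neg_neg]
  calc momentumCreation k' 0 * (momentumCreation (-k') 1 * (momentumAnnihilation (-k) 1 * momentumAnnihilation k 0))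
      = (momentumCreation k' 0 * momentumCreation (-k') 1) * (momentumAnnihilation (-k) 1 * momentumAnnihilation k 0) :=
        (Matrix.mul_assoc _ _ _).symm
    _ = -(momentumCreation (-k') 1 * (momentumCreation k' 0 * (momentumAnnihilation (-k) 1 * momentumAnnihilation k 0))) := by
        rw [h1, neg_mul, Matrix.mul_assoc]
    _ = -(momentumCreation (-k') 1 * ((momentumCreation k' 0 * momentumAnnihilation (-k) 1) * momentumAnnihilation k 0)) := by
        rw [← Matrix.mul_assoc (momentumCreation k' 0) (momentumAnnihilation (-k) 1) (momentumAnnihilation k 0)]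
    _ = momentumCreation (-k') 1 * (momentumAnnihilation (-k) 1 * (momentumCreation k' 0 * momentumAnnihilation k 0)) := by
        rw [h2, neg_mul, Matrix.mul_neg, neg_neg, Matrix.mul_assoc]
    _ = -(momentumCreation (-k') 1 * (momentumAnnihilation (-k) 1 * (momentumAnnihilation k 0 * momentumCreation k' 0))) := by
        rw [h3, Matrix.mul_neg, Matrix.mul_neg]

/-- **Orthogonality below the step**: if `c†_{k'↑} ψ = 0` and `k ≠ k'` then `b†_{k'} b_k ψ = 0`, hence
`⟨b_{k'} ψ, b_k ψ⟩ = 0`. [folklore] -/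
theorem star_pairMode_mulVec_dotProduct_eq_zero {k k' : TorusSite 2 L} (hkk' : k ≠ k')
    {ψ : Fock (Orb (FermionTorus 2 L))} (h : momentumCreation k' 0 *ᵥ ψ = 0) :
    star (pairMode k' *ᵥ ψ) ⬝ᵥ (pairMode k *ᵥ ψ) = 0 := by
  rw [← star_dotProduct_conjTranspose_mulVec', pairMode_conjTranspose, pairMode, mulVec_mulVec,
    Matrix.mul_assoc, creationUp_mul_through hkk', neg_mulVec, ← mulVec_mulVec, ← mulVec_mulVec,
    ← mulVec_mulVec, h, mulVec_zero, mulVec_zero, mulVec_zero, neg_zero, dotProduct_zero]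

/-! ### Euclidean-norm bookkeeping for finite sums -/

omit [NeZero L] in
/-- `‖Σ_{i∈s} v_i‖ ≤ Σ_{i∈s} ‖v_i‖`. [folklore] -/
theorem eucNorm_sum_le {n : Type*} [Fintype n] [DecidableEq n] {ι : Type*} (s : Finset ι) (v : ι → n → ℂ) :
    eucNorm (∑ i ∈ s, v i) ≤ ∑ i ∈ s, eucNorm (v i) := by
  classical
  induction s using Finset.induction_on with
  | empty => simp
  | insert a s ha ih =>
    rw [Finset.sum_insert ha, Finset.sum_insert ha]
    exact (eucNorm_add_le _ _).trans (by linarith)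

omit [NeZero L] in
/-- Expansion of `⟨Σ a_i v_i, Σ a_j v_j⟩` with pairwise orthogonal `v`: only the diagonal survives. [folklore] -/
theorem star_sum_smul_dotProduct_sum_smul_of_orthogonal {n : Type*} [Fintype n] {ι : Type*} [DecidableEq ι]
    (s : Finset ι) (a : ι → ℂ) (v : ι → n → ℂ)
    (horth : ∀ i ∈ s, ∀ j ∈ s, i ≠ j → star (v i) ⬝ᵥ v j = 0) :
    star (∑ i ∈ s, a i • v i) ⬝ᵥ (∑ j ∈ s, a j • v j) = ∑ i ∈ s, (star (a i) * a i) * (star (v i) ⬝ᵥ v i) := by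
  rw [star_sum, sum_dotProduct]
  refine Finset.sum_congr rfl fun i hi => ?_
  rw [dotProduct_sum, Finset.sum_eq_single i]
  · rw [star_smul, smul_dotProduct, dotProduct_smul, smul_eq_mul, smul_eq_mul, mul_assoc]
  · intro j hj hji
    rw [star_smul, smul_dotProduct, dotProduct_smul, horth i hi j hj (Ne.symm hji), smul_zero, smul_zero]
  · intro h; exact absurd hi h

/-! ### The pair bound -/

/-- **Pair intensity against a sharp `↑` Fermi step.** For a unit vector `ψ` with `c_{k↑} ψ = 0` above `μ` and
`c†_{k↑} ψ = 0` below `μ`: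
`re⟨ψ, P†P ψ⟩ ≤ 8 (2·(4 L²) + 2·(2·#{k : ε_L(k) = μ})²)`, `P = pairField dWaveFormFactor L`. [folklore] -/
theorem re_expect_pairIntensity_le_of_fermiStep (μ : ℝ) {ψ : Fock (Orb (FermionTorus 2 L))}
    (hψ1 : star ψ ⬝ᵥ ψ = 1)
    (hA : ∀ k : TorusSite 2 L, μ < torusBand L k → momentumAnnihilation k 0 *ᵥ ψ = 0)
    (hB : ∀ k : TorusSite 2 L, torusBand L k < μ → momentumCreation k 0 *ᵥ ψ = 0) :
    (expect ((pairField dWaveFormFactor L)ᴴ * pairField dWaveFormFactor L) ψ).re ≤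
      8 * (2 * (4 * (L : ℝ) ^ 2) +
        2 * (2 * ((univ.filter fun k : TorusSite 2 L => torusBand L k = μ).card : ℝ)) ^ 2) := by
  classical
  -- the three momentum regions
  set Blo := univ.filter fun k : TorusSite 2 L => torusBand L k < μ with hBlo
  set Lev := univ.filter fun k : TorusSite 2 L => torusBand L k = μ with hLev
  set v : TorusSite 2 L → Fock (Orb (FermionTorus 2 L)) := fun k => pairMode k *ᵥ ψ with hv
  set a : TorusSite 2 L → ℂ := fun k => ((dWaveGap k : ℝ) : ℂ) with ha
  -- `B ψ = Σ_k ĝ_k b_k ψ = Σ_Blo + Σ_Lev` (the region above `μ` contributes nothing)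
  have hBψ : pairOperator dWaveGap univ *ᵥ ψ = ∑ k ∈ Blo, a k • v k + ∑ k ∈ Lev, a k • v k := by
    rw [pairOperator, sum_mulVec]
    simp only [smul_mulVec]
    have hsplit : ∀ f : TorusSite 2 L → Fock (Orb (FermionTorus 2 L)),
        ∑ k, f k = ∑ k ∈ Blo, f k + (∑ k ∈ Lev, f k + ∑ k ∈ univ.filter (fun k => μ < torusBand L k), f k) := by
      intro f
      rw [← Finset.sum_filter_add_sum_filter_not univ (fun k => torusBand L k < μ) f]
      congr 1
      rw [← Finset.sum_filter_add_sum_filter_not (univ.filter fun k => ¬ torusBand L k < μ)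
        (fun k => torusBand L k = μ) f, Finset.filter_filter, Finset.filter_filter]
      congr 1
      · refine Finset.sum_congr ?_ fun _ _ => rfl
        ext k
        simp only [mem_filter, mem_univ, true_and, hLev]
        constructor
        · intro h; exact h.2
        · intro h; exact ⟨by rw [h]; exact lt_irrefl _, h⟩
      · refine Finset.sum_congr ?_ fun _ _ => rfl
        ext k
        simp only [mem_filter, mem_univ, true_and, not_lt]
        constructor
        · intro h; exact lt_of_le_of_ne h.1 (Ne.symm h.2)
        · intro h; exact ⟨h.le, ne_of_gt h⟩
    have hAbv : ∑ k ∈ univ.filter (fun k => μ < torusBand L k), a k • v k = 0 := by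
      refine Finset.sum_eq_zero fun k hk => ?_
      rw [mem_filter] at hk
      rw [hv]
      simp only
      rw [pairMode_mulVec_eq_zero_of_up (hA k hk.2), smul_zero]
    rw [hsplit, hAbv, add_zero]
  -- norms of the pieces
  have hv1 : ∀ k, eucNorm (v k) ≤ 1 := fun k => by
    rw [hv]
    exact (eucNorm_pairMode_mulVec_le k ψ).trans (eucNorm_eq_one hψ1).le
  have ha2 : ∀ k, ‖a k‖ ≤ 2 := fun k => by
    rw [ha]
    simp only [Complex.norm_real, Real.norm_eq_abs]
    exact abs_dWaveGap_le_two k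
  -- below `μ`: orthogonality, `‖x‖² ≤ 4 |Blo| ≤ 4 L²`
  have horth : ∀ i ∈ Blo, ∀ j ∈ Blo, i ≠ j → star (v i) ⬝ᵥ v j = 0 := by
    intro i hi j _ hij
    rw [hBlo, mem_filter] at hi
    exact star_pairMode_mulVec_dotProduct_eq_zero (Ne.symm hij) (hB i hi.2)
  have hx : eucNorm (∑ k ∈ Blo, a k • v k) ^ 2 ≤ 4 * (L : ℝ) ^ 2 := by
    rw [eucNorm_sq, star_sum_smul_dotProduct_sum_smul_of_orthogonal Blo a v horth, Complex.re_sum]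
    have hterm : ∀ k ∈ Blo, ((star (a k) * a k) * (star (v k) ⬝ᵥ v k)).re ≤ 4 := by
      intro k _
      rw [star_dotProduct_self_eq_eucNorm_sq, Complex.star_def, Complex.conj_mul', ← Complex.ofReal_pow,
        ← Complex.ofReal_mul, Complex.ofReal_re]
      have h1 : ‖a k‖ ^ 2 ≤ 4 := by nlinarith [ha2 k, norm_nonneg (a k)]
      have h2 : eucNorm (v k) ^ 2 ≤ 1 := by nlinarith [hv1 k, eucNorm_nonneg (v k)]
      nlinarith [sq_nonneg ‖a k‖, sq_nonneg (eucNorm (v k))]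
    calc ∑ k ∈ Blo, ((star (a k) * a k) * (star (v k) ⬝ᵥ v k)).re ≤ ∑ _k ∈ Blo, (4:ℝ) :=
          Finset.sum_le_sum hterm
      _ = 4 * Blo.card := by rw [sum_const, nsmul_eq_mul, mul_comm]
      _ ≤ 4 * (L : ℝ) ^ 2 := by
          have : Blo.card ≤ L ^ 2 := by
            calc Blo.card ≤ (univ : Finset (TorusSite 2 L)).card := card_le_card (filter_subset _ _)
              _ = L ^ 2 := by rw [card_univ, Fintype.card_pi, Fin.prod_const, ZMod.card]
          have : (Blo.card : ℝ) ≤ (L : ℝ) ^ 2 := by exact_mod_cast this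
          linarith
  -- on the level set: triangle inequality, `‖y‖ ≤ 2 |Lev|`
  have hy : eucNorm (∑ k ∈ Lev, a k • v k) ≤ 2 * (Lev.card : ℝ) := by
    calc eucNorm (∑ k ∈ Lev, a k • v k) ≤ ∑ k ∈ Lev, eucNorm (a k • v k) := eucNorm_sum_le Lev _
      _ ≤ ∑ _k ∈ Lev, (2:ℝ) := Finset.sum_le_sum fun k _ => by
          rw [eucNorm_smul]
          nlinarith [ha2 k, hv1 k, norm_nonneg (a k), eucNorm_nonneg (v k)]
      _ = 2 * Lev.card := by rw [sum_const, nsmul_eq_mul, mul_comm]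
  -- assemble
  have hP : pairField dWaveFormFactor L *ᵥ ψ =
      -(((2 * Real.sqrt 2 : ℝ) : ℂ) • (pairOperator dWaveGap univ *ᵥ ψ)) := by
    rw [pairField_dWave_eq_smul_pairOperator, neg_mulVec, smul_mulVec]
  have hexp : (Literature.MathematicalPhysics.QuantumLattice.expect
      ((pairField dWaveFormFactor L)ᴴ * pairField dWaveFormFactor L) ψ).re =
      8 * eucNorm (pairOperator dWaveGap univ *ᵥ ψ) ^ 2 := by
    rw [Literature.MathematicalPhysics.QuantumLattice.expect, ← mulVec_mulVec,
      star_dotProduct_conjTranspose_mulVec', ← eucNorm_sq, hP, eucNorm_neg, eucNorm_smul, mul_pow,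
      Complex.norm_real, Real.norm_eq_abs, abs_of_pos (by positivity), mul_pow, Real.sq_sqrt (by norm_num)]
    norm_num
  rw [hexp, hBψ]
  have hsum := eucNorm_add_le (∑ k ∈ Blo, a k • v k) (∑ k ∈ Lev, a k • v k)
  have h0x := eucNorm_nonneg (∑ k ∈ Blo, a k • v k)
  have h0y := eucNorm_nonneg (∑ k ∈ Lev, a k • v k)
  have h0s := eucNorm_nonneg (∑ k ∈ Blo, a k • v k + ∑ k ∈ Lev, a k • v k)
  have hy2 : eucNorm (∑ k ∈ Lev, a k • v k) ^ 2 ≤ (2 * (Lev.card : ℝ)) ^ 2 := by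
    nlinarith [hy, h0y]
  nlinarith [hsum, h0x, h0y, h0s, hx, hy2, sq_nonneg (eucNorm (∑ k ∈ Blo, a k • v k) - eucNorm (∑ k ∈ Lev, a k • v k))]

end Summit.HubbardSuperconductivity.CwThesis.Negative

end
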